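/-
Copyright: the b2b-balaban T⁴-continuum CRUX team, row NE7b OWNER lineage `t4-ne7b-p1` (gen 144). Project licence.
-/
import Summits.QuantumFields.BalabanUV.T4Continuum.Spine.NE7b.SupFifthKernelPermutations
import Summits.QuantumFields.BalabanUV.T4Continuum.Spine.NE7b.SupWhitenedFifthTwoPointEntries
import Summits.QuantumFields.BalabanUV.T4Continuum.Spine.NE7b.SupFifthFormGroupsOne
import Summits.QuantumFields.BalabanUV.T4Continuum.Spine.NE7b.SupWhitenedFifthTwoPointEntriesTwo
import Summits.QuantumFields.BalabanUV.T4Continuum.Spine.NE7b.SupFifthKernelSums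
import Summits.QuantumFields.BalabanUV.T4Continuum.Spine.NE7b.SupWhitenedFifthThreePointRowLetters
import Summits.QuantumFields.BalabanUV.T4Continuum.Spine.NE7b.SupBlockFifthKernelAverage
import Summits.QuantumFields.BalabanUV.T4Continuum.Spine.NE7b.SupFifthKernelTwoPointLetters

/-!
# THE ORDER-FIVE KERNEL LETTER, GROUPS ONE TO THREE (SCOPING (d15′)(vi)): for `Γ = AAᵀ` and the row index `x` carried by the
# differentiation direction, the quadruple row sums `Σ_{y,z,t,s} |d∕dσ G_i(ψ + σe_x)[e_y,e_z,e_t,e_s]|_{σ=0}` of the first three groups of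
# (521)'s centred display of `∂⁴W` — the mean `⟨U⁗⟩`, the four raw covariances `Cov(U‴,U′)`, the three `Cov(U″,U″)` — are bounded by the input's
# letters: (591) gives each derivative as 2 ∕ 12 ∕ 9 placements of the order-5 display; every placement is a piece file's row letter ((580);
# (562)∕(563) entries + (564) letters; (575)) after a reindexing of `(y,z,t,s)` ((595) `sum4_*`) and, where the tilt factor `A_x = U′(·)e_x`
# is not in front, an integrand permutation ((596) `cov_rowsum_symm`, `cm3_rowsum_*`) — all by unification, pattern of (523)
# (row NE7b, node U5c; (562) (563) (564) (575) (580) (591) (595) (596) BY NAME; [folklore]; Gross 1979 ∕ Künsch 1982 territory)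

Cell `pub-balaban`, sub-cell `t4`, spine estimate NE7b (`T4WeightBudget.RelWeightBound`; the cell's OWN estimate — NOT PRINTED in
[Bałaban 1983–89], NOT PROVED).  Crux-route work under `Spine/NE7b/` by the row OWNER (`t4-ne7b-p1` gen 144, file (597)) under FREEZE
(0)'s crux-prover clause; NOTHING of Bałaban's is named as a Lean object, valued or asserted; no `T4Continuum/Support` leaf typed; no
`def`, no notation (the group functions WRITTEN OUT as in (521)∕(591)–(594); the derivative values never restated — `deriv` of the group
function, rewritten by the group theorem inside the proof); zero `sorry`.

WHAT IS PROVED ([folklore]): **`fifth_kernel_group_mean`**, **`fifth_kernel_group_covCA`**, **`fifth_kernel_group_covBB`**; toy.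

HONEST (what this is NOT).  Three of the five groups; groups four (κ₃ᶜ, 24 placements) and five (u₄, 5 placements) and THE END (the order-5 kernel
letter
`Σ|∂⁵W| ≤ Σ L_i` with (521)'s display differentiated under `deriv`) are the next files.  The GEOMETRY letters (weights `θ, σ, ρ, r`, the
admissible `D`, the site letters `S, S′, S₁`, the support counts `n, n₃`; `αr, αc`) stay letters ((476)∕(485)∕(510)∕(561) supply them for the
road's finite-range factor).  Scalar skeleton ((A3), NC-NE7b-α UNRULED); nothing of Bałaban's asserted.  BY-NAME EFFECT ON THE WALL: NONE.
NE7b NOT PRINTED ∕ NOT PROVED; spine PROVED 0∕9; rung (B)+1 — the programme's measures remain FINITE-torus statements; NOT the mass gap, NOT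
Clay.  HONEST DEPENDENCY: continuum YM on T⁴ ⇐ BetaPertH ∧ nine spine estimates (0∕9 proved); BetaPertH ⇐ (D1) ∧ (D4) ∧ CAP+tail; G-an2-4
gates asym, D1 and NE2∕3∕4.
-/

set_option autoImplicit false
set_option maxSynthPendingDepth 4

noncomputable section

namespace Summit.QuantumFields.BalabanUV.T4Continuum.NE7b.SupFifthKernelGroupsOne

open MeasureTheory ProbabilityTheory Finset Real Matrix
open scoped BigOperators Matrix
open SupEffectiveActionDerivative (mul_opBound_le_of_le)
open SupWhitenedMomentLetters (posSemidef_AAT)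
open SupFifthKernelPermutations (cm3_rowsum_cyc cm3_rowsum_swap13 cov_rowsum_symm)
open SupWhitenedFifthTwoPointEntries (fourthgrad_cov_entry gradfourth_cov_entry)
open SupFifthFormGroupsOne (hasDerivAt_display4_covBB_line hasDerivAt_display4_covCA_line hasDerivAt_display4_mean_line)
open SupWhitenedFifthTwoPointEntriesTwo (hessthird_cov_entry thirdhess_cov_entry)
open SupFifthKernelSums (sum4_abs_split_cov3 sum4_abs_split_cov4 sum4_abs_split_mean sum4_syzt sum4_tsyz sum4_tyzs sum4_yszt sum4_ytsz sum4_ytzs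
  sum4_yzst sum4_zsyt sum4_ztsy sum4_ztys sum4_zyts)
open SupWhitenedFifthThreePointRowLetters (three_point5_row_letter_hesshess_two three_point5_row_letter_third_two)
open SupBlockFifthKernelAverage (tilted_fifth_average_rowsum)
open SupFifthKernelTwoPointLetters (two_point5_hess_first_sum_le two_point5_lone_first_sum_le two_point5_lone_last_sum_le
  two_point5_third_first_sum_le)

variable {ι κ : Type} [Fintype ι] [DecidableEq ι] [Fintype κ] [DecidableEq κ]

variable {U : EuclideanSpace ℝ ι → ℝ} {U' : EuclideanSpace ℝ ι → EuclideanSpace ℝ ι →L[ℝ] ℝ}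
  {U'' : EuclideanSpace ℝ ι → EuclideanSpace ℝ ι →L[ℝ] EuclideanSpace ℝ ι →L[ℝ] ℝ}
  {U₃ : EuclideanSpace ℝ ι → EuclideanSpace ℝ ι →L[ℝ] EuclideanSpace ℝ ι →L[ℝ] EuclideanSpace ℝ ι →L[ℝ] ℝ}
  {U₄ : EuclideanSpace ℝ ι → EuclideanSpace ℝ ι →L[ℝ] EuclideanSpace ℝ ι →L[ℝ] EuclideanSpace ℝ ι →L[ℝ] EuclideanSpace ℝ ι →L[ℝ] ℝ}
  {U₅ : EuclideanSpace ℝ ι →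
    EuclideanSpace ℝ ι →L[ℝ] EuclideanSpace ℝ ι →L[ℝ] EuclideanSpace ℝ ι →L[ℝ] EuclideanSpace ℝ ι →L[ℝ] EuclideanSpace ℝ ι →L[ℝ] ℝ}
  {Hk : ι → ι → ℝ} {K3 : ι → ι → ι → ℝ} {K4 : ι → ι → ι → ι → ℝ} {K5 : ι → ι → ι → ι → ι → ℝ} {A : Matrix ι κ ℝ} {D : κ → κ → ℝ}
  {γop κ₀ κ₁ κ₂ κ₃ κ₄ κ₅ κ₅r a τ δ θp lam lamA αr αc hr hc k3r k3c k4r k4c k5r k5c γ dr dc dθ dθ' αθ βθ S S' S₁ n₃ : ℝ} {θ : κ → κ → ℝ}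
  {σ : ι → κ → ℝ} {ρ r : ι → ι → ℝ} {n : ℕ}

set_option synthInstance.maxHeartbeats 200000 in
set_option maxHeartbeats 400000 in
/-- **Group one (the mean group)**: the row letter of `d∕dσ ⟨U⁗yzts⟩ = ⟨U⁽⁵⁾xyzts⟩ − Cov(U⁗yzts, A_x)` — (580) and, after the raw covariance
symmetry, (562)'s `Cov(U′x, U⁗yzts)` entry with (564)'s letter. [folklore] -/
theorem fifth_kernel_group_mean [Nonempty κ]
    (hΓop : (γop • (1 : Matrix ι ι ℝ) - A * Aᵀ).PosSemidef) (Y : Finset ι) (hUd : ∀ φ : EuclideanSpace ℝ ι, HasFDerivAt U (U' φ) φ)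
    (hU'd : ∀ φ : EuclideanSpace ℝ ι, HasFDerivAt U' (U'' φ) φ) (hU₄d : ∀ φ : EuclideanSpace ℝ ι, HasFDerivAt U₄ (U₅ φ) φ) (hU₅c : Continuous U₅)
    (hκ₀ : 0 ≤ κ₀) (hκ₁ : 0 ≤ κ₁) (ha : 0 ≤ a) (hτ : 0 < τ) (hδ : 0 < δ) (hθ0 : 0 < θp) (hθ1 : θp < 1) (hκθ : (2 * κ₀ * (1 + τ) + 4 * δ) * γop ≤ θp)
    (hκθw : 2 * κ₀ * (1 + τ) * γop + 4 * δ ≤ θp) (hstab : ∀ φ : EuclideanSpace ℝ ι, -(κ₀ * ∑ x ∈ Y, φ x ^ 2) ≤ U φ)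
    (hU'b : ∀ φ : EuclideanSpace ℝ ι, ‖U' φ‖ ≤ κ₁ * (a + ∑ x ∈ Y, φ x ^ 2)) (hU''b : ∀ φ : EuclideanSpace ℝ ι, ‖U'' φ‖ ≤ κ₂)
    (hU₄b : ∀ φ : EuclideanSpace ℝ ι, ‖U₄ φ‖ ≤ κ₄) (hU₅b : ∀ φ : EuclideanSpace ℝ ι, ‖U₅ φ‖ ≤ κ₅)
    (hHk : ∀ (φ : EuclideanSpace ℝ ι) (x z : ι), |U'' φ (EuclideanSpace.single z (1 : ℝ)) (EuclideanSpace.single x (1 : ℝ))| ≤ Hk x z)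
    (hHk0 : ∀ v u, 0 ≤ Hk v u)
    (hK5 : ∀ (φ : EuclideanSpace ℝ ι) (u x y z t : ι), |U₅ φ (EuclideanSpace.single u (1 : ℝ)) (EuclideanSpace.single x (1 : ℝ))
      (EuclideanSpace.single y (1 : ℝ)) (EuclideanSpace.single z (1 : ℝ)) (EuclideanSpace.single t (1 : ℝ))| ≤ K5 x y z t u)
    (hK50 : ∀ x y z t u, 0 ≤ K5 x y z t u)
    (hU₅row : ∀ (φ : EuclideanSpace ℝ ι) (x : ι), ∑ y, ∑ z, ∑ t, ∑ s, |U₅ φ (EuclideanSpace.single x (1 : ℝ)) (EuclideanSpace.single y (1 : ℝ))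
      (EuclideanSpace.single z (1 : ℝ)) (EuclideanSpace.single t (1 : ℝ)) (EuclideanSpace.single s (1 : ℝ))| ≤ κ₅r)
    (hhr : ∀ v, ∑ u, Hk v u ≤ hr) (hk5c : ∀ u, ∑ y, ∑ z, ∑ t, ∑ s, K5 y z t s u ≤ k5c) (ψ : EuclideanSpace ℝ ι) (hαr : ∀ u, ∑ w, |A u w| ≤ αr)
    (hαc : ∀ w, ∑ u, |A u w| ≤ αc) (hlamA : ∀ x : κ, ∑ u, ∑ v, |A u x| * |A v x| * Hk v u ≤ lamA) (hlamA1 : lamA < 1)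
    (hγ : αc * hr * αr / (1 - lamA) ≤ γ) (hγ1 : γ < 1) (hD : ∀ x y, 0 ≤ D x y)
    (hDC : ∀ x y, (if x = y then (1 : ℝ) else 0) + ∑ z, D x z * ((if y = z then 0 else ∑ u, ∑ v, |A u y| * |A v z| * Hk v u) / (1 - lamA)) ≤ D x y)
    (hDr : ∀ z, ∑ w, D z w ≤ dr) (hDc : ∀ w, ∑ z, D z w ≤ dc) (x : ι) :
    ∑ y, ∑ z, ∑ t, ∑ s, |deriv (fun σ : ℝ => ((∫ ω : EuclideanSpace ℝ ι, exp (-U (ω + (ψ + σ • EuclideanSpace.single x (1 : ℝ))))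
        ∂(multivariateGaussian 0 (A * Aᵀ)))⁻¹ * (∫ ω : EuclideanSpace ℝ ι, exp (-U (ω + (ψ + σ • EuclideanSpace.single x (1 : ℝ)))) * U₄ (ω + (ψ + σ
        • EuclideanSpace.single x (1 : ℝ))) (EuclideanSpace.single y (1 : ℝ)) (EuclideanSpace.single z (1 : ℝ)) (EuclideanSpace.single t (1 : ℝ))
        (EuclideanSpace.single s (1 : ℝ)) ∂(multivariateGaussian 0 (A * Aᵀ))))) 0| ≤
      κ₅r +
        hr * αr * (αc * k5c) * dr * dc / (1 - lamA) := by
  have hΓ : (A * Aᵀ).PosSemidef := posSemidef_AAT A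
  have hκθ' : 2 * κ₀ * (1 + τ) * γop ≤ θp := mul_opBound_le_of_le (by positivity) (by linarith) hθ0.le hκθ
  have hl1 : 0 < 1 - lamA := by linarith
  -- the group's derivative, entry by entry (`hasDerivAt_display4_mean_line`)
  apply Eq.trans_le
  · exact Finset.sum_congr rfl fun y _ => Finset.sum_congr rfl fun z _ => Finset.sum_congr rfl fun t _ => Finset.sum_congr rfl fun s _ =>
      congrArg abs (hasDerivAt_display4_mean_line hΓ hΓop Y hUd hU'd hU₄d hU₅c hκ₀ hκ₁ ha hτ hδ hθ0 hθ1 hκθ hstab hU'b hU''b hU₄b hU₅b ψ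
          (EuclideanSpace.single x (1 : ℝ)) (EuclideanSpace.single y (1 : ℝ)) (EuclideanSpace.single z (1 : ℝ)) (EuclideanSpace.single t (1 : ℝ))
          (EuclideanSpace.single s (1 : ℝ))).deriv
  -- the placements' row letters (pieces BY NAME; reindexed by (595), `x`-factor to the front by (596))
  have h1 := tilted_fifth_average_rowsum hΓ hΓop Y hUd hU₅c hκ₀ hτ hδ hθ0 hθ1 hκθ hstab hU₅b hU₅row ψ x
  have h2 := ((cov_rowsum_symm _ _ _ _ _ _).trans_le ((Finset.sum_le_sum fun y _ => Finset.sum_le_sum fun z _ => Finset.sum_le_sum fun t _ =>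
      Finset.sum_le_sum fun s _ => gradfourth_cov_entry hΓop Y hUd hU'd hU₄d hHk hHk0 hK5 hκ₀ hτ hδ hθ1 hκθ' hκθw hstab ψ hαr hαc hhr hlamA hlamA1 hγ
      hγ1 hD hDC x y z t s).trans (two_point5_lone_first_sum_le hK50 hHk0 hαr hαc hhr hk5c hD hDr hDc hl1 x)))
  beta_reduce at h2
  -- assemble
  refine (sum4_abs_split_mean _ _).trans ?_
  have hsum := add_le_add h1 h2
  exact hsum.trans (le_of_eq (by ring))

set_option synthInstance.maxHeartbeats 200000 in
set_option maxHeartbeats 400000 in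
/-- **Group two (the `Cov(C,A)` group)**: the row letter of the four differentiated raw covariances `Cov(U‴·,U′·)` — twelve placements: (562)∕(563)
entries with (564)'s letters, (575)'s `κ₃ᶜ(U′x, U‴·, U′·)` letter; reindexed ((595)) and with the `x`-factor moved to the front ((596)). [folklore]
-/
theorem fifth_kernel_group_covCA [Nonempty κ]
    (hΓop : (γop • (1 : Matrix ι ι ℝ) - A * Aᵀ).PosSemidef) (Y : Finset ι) (hUd : ∀ φ : EuclideanSpace ℝ ι, HasFDerivAt U (U' φ) φ)
    (hU'd : ∀ φ : EuclideanSpace ℝ ι, HasFDerivAt U' (U'' φ) φ) (hU''d : ∀ φ : EuclideanSpace ℝ ι, HasFDerivAt U'' (U₃ φ) φ)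
    (hU₃d : ∀ φ : EuclideanSpace ℝ ι, HasFDerivAt U₃ (U₄ φ) φ) (hU₄d : ∀ φ : EuclideanSpace ℝ ι, HasFDerivAt U₄ (U₅ φ) φ) (hκ₀ : 0 ≤ κ₀)
    (hκ₁ : 0 ≤ κ₁) (ha : 0 ≤ a) (hτ : 0 < τ) (hδ : 0 < δ) (hθ0 : 0 < θp) (hθ1 : θp < 1) (hκθ : (2 * κ₀ * (1 + τ) + 4 * δ) * γop ≤ θp)
    (hκθw : 2 * κ₀ * (1 + τ) * γop + 4 * δ ≤ θp) (hstab : ∀ φ : EuclideanSpace ℝ ι, -(κ₀ * ∑ x ∈ Y, φ x ^ 2) ≤ U φ)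
    (hU'b : ∀ φ : EuclideanSpace ℝ ι, ‖U' φ‖ ≤ κ₁ * (a + ∑ x ∈ Y, φ x ^ 2)) (hU''b : ∀ φ : EuclideanSpace ℝ ι, ‖U'' φ‖ ≤ κ₂)
    (hU₃b : ∀ φ : EuclideanSpace ℝ ι, ‖U₃ φ‖ ≤ κ₃) (hU₄b : ∀ φ : EuclideanSpace ℝ ι, ‖U₄ φ‖ ≤ κ₄) (hlam : 0 ≤ lam)
    (hUsec : ∀ s : ℝ, 0 ≤ s → s ≤ 1 → ∀ a b : EuclideanSpace ℝ ι,
      U ((1 - s) • a + s • b) - lam / 2 * (s * (1 - s)) * ∑ i, (a i - b i) ^ 2 ≤ (1 - s) * U a + s * U b)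
    (hρg : lam * γop < 1)
    (hHk : ∀ (φ : EuclideanSpace ℝ ι) (x z : ι), |U'' φ (EuclideanSpace.single z (1 : ℝ)) (EuclideanSpace.single x (1 : ℝ))| ≤ Hk x z)
    (hHk0 : ∀ v u, 0 ≤ Hk v u)
    (hK3 : ∀ (φ : EuclideanSpace ℝ ι) (u x y : ι),
      |U₃ φ (EuclideanSpace.single u (1 : ℝ)) (EuclideanSpace.single x (1 : ℝ)) (EuclideanSpace.single y (1 : ℝ))| ≤ K3 x y u)
    (hK30 : ∀ x y u, 0 ≤ K3 x y u)
    (hK4 : ∀ (φ : EuclideanSpace ℝ ι) (u x y z : ι), |U₄ φ (EuclideanSpace.single u (1 : ℝ)) (EuclideanSpace.single x (1 : ℝ))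
      (EuclideanSpace.single y (1 : ℝ)) (EuclideanSpace.single z (1 : ℝ))| ≤ K4 x y z u)
    (hK40 : ∀ x y z u, 0 ≤ K4 x y z u)
    (hK5 : ∀ (φ : EuclideanSpace ℝ ι) (u x y z t : ι), |U₅ φ (EuclideanSpace.single u (1 : ℝ)) (EuclideanSpace.single x (1 : ℝ))
      (EuclideanSpace.single y (1 : ℝ)) (EuclideanSpace.single z (1 : ℝ)) (EuclideanSpace.single t (1 : ℝ))| ≤ K5 x y z t u)
    (hK50 : ∀ x y z t u, 0 ≤ K5 x y z t u) (hhr : ∀ v, ∑ u, Hk v u ≤ hr) (hhc : ∀ u, ∑ v, Hk v u ≤ hc) (hk3r : ∀ x, ∑ y, ∑ u, K3 x y u ≤ k3r)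
    (hk4c : ∀ u, ∑ y, ∑ z, ∑ t, K4 y z t u ≤ k4c) (hk5r : ∀ x, ∑ y, ∑ z, ∑ t, ∑ u, K5 x y z t u ≤ k5r) (ψ : EuclideanSpace ℝ ι)
    (hαr : ∀ u, ∑ w, |A u w| ≤ αr) (hαc : ∀ w, ∑ u, |A u w| ≤ αc) (hlamA : ∀ x : κ, ∑ u, ∑ v, |A u x| * |A v x| * Hk v u ≤ lamA) (hlamA1 : lamA < 1)
    (hγ : αc * hr * αr / (1 - lamA) ≤ γ) (hγ1 : γ < 1) (hD : ∀ x y, 0 ≤ D x y)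
    (hDC : ∀ x y, (if x = y then (1 : ℝ) else 0) + ∑ z, D x z * ((if y = z then 0 else ∑ u, ∑ v, |A u y| * |A v z| * Hk v u) / (1 - lamA)) ≤ D x y)
    (hDr : ∀ z, ∑ w, D z w ≤ dr) (hDc : ∀ w, ∑ z, D z w ≤ dc) (hθnn : ∀ z w, 0 ≤ θ z w) (hDθr : ∀ z, ∑ w, D z w * θ z w ≤ dθ) (hdθ : 0 ≤ dθ)
    (hDθc : ∀ w, ∑ z, D z w * θ z w ≤ dθ') (hdθ' : 0 ≤ dθ') (hσ0 : ∀ x w, 0 ≤ σ x w) (hσθ : ∀ x z w, σ x w ≤ σ x z * θ z w) (hρ1 : ∀ x y, 1 ≤ ρ x y)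
    (hρsymm : ∀ x y, ρ x y = ρ y x) (hρmul : ∀ x y z, ρ x z ≤ ρ x y * ρ y z) (hρσ : ∀ x y w, ρ x y ^ 8 ≤ σ x w * σ y w)
    (haσ : ∀ v : ι, ∑ w, (∑ u, |A u w| * Hk v u) * σ v w ≤ αθ) (hβ : 0 ≤ βθ) (haσ' : ∀ (v : ι) (w : κ), (∑ u, |A u w| * Hk v u) * σ v w ≤ βθ)
    (hkσ : ∀ p q o : ι, ∑ w, (∑ u, |A u w| * K4 p q o u) * σ p w ≤ αθ) (hkσ' : ∀ (p q o : ι) (w : κ), (∑ u, |A u w| * K4 p q o u) * σ p w ≤ βθ)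
    (x : ι) (hS : ∑ v, 1 / ρ x v ≤ S) (hn3 : ∀ y : ι, ∑ z, ((Finset.univ.filter (fun t => K3 z t y ≠ 0)).card : ℝ) ≤ n₃) :
    ∑ y, ∑ z, ∑ t, ∑ s, |deriv (fun σ : ℝ => ((∫ ω : EuclideanSpace ℝ ι, exp (-U (ω + (ψ + σ • EuclideanSpace.single x (1 : ℝ))))
        ∂(multivariateGaussian 0 (A * Aᵀ)))⁻¹ * (∫ ω : EuclideanSpace ℝ ι, exp (-U (ω + (ψ + σ • EuclideanSpace.single x (1 : ℝ)))) * (U₃ (ω + (ψ + σ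
        • EuclideanSpace.single x (1 : ℝ))) (EuclideanSpace.single y (1 : ℝ)) (EuclideanSpace.single t (1 : ℝ)) (EuclideanSpace.single s (1 : ℝ)) *
        U' (ω + (ψ + σ • EuclideanSpace.single x (1 : ℝ))) (EuclideanSpace.single z (1 : ℝ))) ∂(multivariateGaussian 0 (A * Aᵀ))) - ((∫ ω :
        EuclideanSpace ℝ ι, exp (-U (ω + (ψ + σ • EuclideanSpace.single x (1 : ℝ)))) ∂(multivariateGaussian 0 (A * Aᵀ))) ^ 2)⁻¹ * ((∫ ω :
        EuclideanSpace ℝ ι, exp (-U (ω + (ψ + σ • EuclideanSpace.single x (1 : ℝ)))) * U₃ (ω + (ψ + σ • EuclideanSpace.single x (1 : ℝ)))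
        (EuclideanSpace.single y (1 : ℝ)) (EuclideanSpace.single t (1 : ℝ)) (EuclideanSpace.single s (1 : ℝ)) ∂(multivariateGaussian 0 (A * Aᵀ))) *
        (∫ ω : EuclideanSpace ℝ ι, exp (-U (ω + (ψ + σ • EuclideanSpace.single x (1 : ℝ)))) * U' (ω + (ψ + σ • EuclideanSpace.single x (1 : ℝ)))
        (EuclideanSpace.single z (1 : ℝ)) ∂(multivariateGaussian 0 (A * Aᵀ))))) +
        ((∫ ω : EuclideanSpace ℝ ι, exp (-U (ω + (ψ + σ • EuclideanSpace.single x (1 : ℝ)))) ∂(multivariateGaussian 0 (A * Aᵀ)))⁻¹ * (∫ ω :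
            EuclideanSpace ℝ ι, exp (-U (ω + (ψ + σ • EuclideanSpace.single x (1 : ℝ)))) * (U₃ (ω + (ψ + σ • EuclideanSpace.single x (1 : ℝ)))
            (EuclideanSpace.single y (1 : ℝ)) (EuclideanSpace.single z (1 : ℝ)) (EuclideanSpace.single s (1 : ℝ)) * U' (ω + (ψ + σ •
            EuclideanSpace.single x (1 : ℝ))) (EuclideanSpace.single t (1 : ℝ))) ∂(multivariateGaussian 0 (A * Aᵀ))) - ((∫ ω : EuclideanSpace ℝ ι,
            exp (-U (ω + (ψ + σ • EuclideanSpace.single x (1 : ℝ)))) ∂(multivariateGaussian 0 (A * Aᵀ))) ^ 2)⁻¹ * ((∫ ω : EuclideanSpace ℝ ι, exp (-U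
            (ω + (ψ + σ • EuclideanSpace.single x (1 : ℝ)))) * U₃ (ω + (ψ + σ • EuclideanSpace.single x (1 : ℝ))) (EuclideanSpace.single y (1 : ℝ))
            (EuclideanSpace.single z (1 : ℝ)) (EuclideanSpace.single s (1 : ℝ)) ∂(multivariateGaussian 0 (A * Aᵀ))) * (∫ ω : EuclideanSpace ℝ ι, exp
            (-U (ω + (ψ + σ • EuclideanSpace.single x (1 : ℝ)))) * U' (ω + (ψ + σ • EuclideanSpace.single x (1 : ℝ))) (EuclideanSpace.single t (1 :
            ℝ)) ∂(multivariateGaussian 0 (A * Aᵀ))))) +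
        ((∫ ω : EuclideanSpace ℝ ι, exp (-U (ω + (ψ + σ • EuclideanSpace.single x (1 : ℝ)))) ∂(multivariateGaussian 0 (A * Aᵀ)))⁻¹ * (∫ ω :
            EuclideanSpace ℝ ι, exp (-U (ω + (ψ + σ • EuclideanSpace.single x (1 : ℝ)))) * (U₃ (ω + (ψ + σ • EuclideanSpace.single x (1 : ℝ)))
            (EuclideanSpace.single y (1 : ℝ)) (EuclideanSpace.single z (1 : ℝ)) (EuclideanSpace.single t (1 : ℝ)) * U' (ω + (ψ + σ •
            EuclideanSpace.single x (1 : ℝ))) (EuclideanSpace.single s (1 : ℝ))) ∂(multivariateGaussian 0 (A * Aᵀ))) - ((∫ ω : EuclideanSpace ℝ ι,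
            exp (-U (ω + (ψ + σ • EuclideanSpace.single x (1 : ℝ)))) ∂(multivariateGaussian 0 (A * Aᵀ))) ^ 2)⁻¹ * ((∫ ω : EuclideanSpace ℝ ι, exp (-U
            (ω + (ψ + σ • EuclideanSpace.single x (1 : ℝ)))) * U₃ (ω + (ψ + σ • EuclideanSpace.single x (1 : ℝ))) (EuclideanSpace.single y (1 : ℝ))
            (EuclideanSpace.single z (1 : ℝ)) (EuclideanSpace.single t (1 : ℝ)) ∂(multivariateGaussian 0 (A * Aᵀ))) * (∫ ω : EuclideanSpace ℝ ι, exp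
            (-U (ω + (ψ + σ • EuclideanSpace.single x (1 : ℝ)))) * U' (ω + (ψ + σ • EuclideanSpace.single x (1 : ℝ))) (EuclideanSpace.single s (1 :
            ℝ)) ∂(multivariateGaussian 0 (A * Aᵀ))))) +
        ((∫ ω : EuclideanSpace ℝ ι, exp (-U (ω + (ψ + σ • EuclideanSpace.single x (1 : ℝ)))) ∂(multivariateGaussian 0 (A * Aᵀ)))⁻¹ * (∫ ω :
            EuclideanSpace ℝ ι, exp (-U (ω + (ψ + σ • EuclideanSpace.single x (1 : ℝ)))) * (U' (ω + (ψ + σ • EuclideanSpace.single x (1 : ℝ)))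
            (EuclideanSpace.single y (1 : ℝ)) * U₃ (ω + (ψ + σ • EuclideanSpace.single x (1 : ℝ))) (EuclideanSpace.single z (1 : ℝ))
            (EuclideanSpace.single t (1 : ℝ)) (EuclideanSpace.single s (1 : ℝ))) ∂(multivariateGaussian 0 (A * Aᵀ))) - ((∫ ω : EuclideanSpace ℝ ι,
            exp (-U (ω + (ψ + σ • EuclideanSpace.single x (1 : ℝ)))) ∂(multivariateGaussian 0 (A * Aᵀ))) ^ 2)⁻¹ * ((∫ ω : EuclideanSpace ℝ ι, exp (-U
            (ω + (ψ + σ • EuclideanSpace.single x (1 : ℝ)))) * U' (ω + (ψ + σ • EuclideanSpace.single x (1 : ℝ))) (EuclideanSpace.single y (1 : ℝ))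
            ∂(multivariateGaussian 0 (A * Aᵀ))) * (∫ ω : EuclideanSpace ℝ ι, exp (-U (ω + (ψ + σ • EuclideanSpace.single x (1 : ℝ)))) * U₃ (ω + (ψ +
            σ • EuclideanSpace.single x (1 : ℝ))) (EuclideanSpace.single z (1 : ℝ)) (EuclideanSpace.single t (1 : ℝ)) (EuclideanSpace.single s (1 :
            ℝ)) ∂(multivariateGaussian 0 (A * Aᵀ)))))) 0| ≤
      αr * k5r * (αc * hc) * dr * dc / (1 - lamA) +
        αr * k3r * (αc * k4c) * dr * dc / (1 - lamA) +
        n₃ * ((4 * Real.sqrt ((5 * ((κ₂ ^ 4 + κ₄ ^ 4) * γop ^ 2) / (1 - lam * γop) ^ 2) * (αθ * dθ * (βθ * dθ') / (1 - lamA)))) * S ^ 2) +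
        αr * k5r * (αc * hc) * dr * dc / (1 - lamA) +
        αr * k3r * (αc * k4c) * dr * dc / (1 - lamA) +
        n₃ * ((4 * Real.sqrt ((5 * ((κ₂ ^ 4 + κ₄ ^ 4) * γop ^ 2) / (1 - lam * γop) ^ 2) * (αθ * dθ * (βθ * dθ') / (1 - lamA)))) * S ^ 2) +
        αr * k5r * (αc * hc) * dr * dc / (1 - lamA) +
        αr * k3r * (αc * k4c) * dr * dc / (1 - lamA) +
        n₃ * ((4 * Real.sqrt ((5 * ((κ₂ ^ 4 + κ₄ ^ 4) * γop ^ 2) / (1 - lam * γop) ^ 2) * (αθ * dθ * (βθ * dθ') / (1 - lamA)))) * S ^ 2) +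
        αr * k3r * (αc * k4c) * dr * dc / (1 - lamA) +
        αr * k5r * (αc * hc) * dr * dc / (1 - lamA) +
        n₃ * ((4 * Real.sqrt ((5 * ((κ₂ ^ 4 + κ₄ ^ 4) * γop ^ 2) / (1 - lam * γop) ^ 2) * (αθ * dθ * (βθ * dθ') / (1 - lamA)))) * S ^ 2) := by
  have hΓ : (A * Aᵀ).PosSemidef := posSemidef_AAT A
  have hU₄c : Continuous U₄ := continuous_iff_continuousAt.2 fun φ => (hU₄d φ).continuousAt
  have hκθ' : 2 * κ₀ * (1 + τ) * γop ≤ θp := mul_opBound_le_of_le (by positivity) (by linarith) hθ0.le hκθ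
  have hl1 : 0 < 1 - lamA := by linarith
  -- the group's derivative, entry by entry (`hasDerivAt_display4_covCA_line`)
  apply Eq.trans_le
  · exact Finset.sum_congr rfl fun y _ => Finset.sum_congr rfl fun z _ => Finset.sum_congr rfl fun t _ => Finset.sum_congr rfl fun s _ =>
      congrArg abs (hasDerivAt_display4_covCA_line hΓ hΓop Y hUd hU'd hU''d hU₃d hU₄c hκ₀ hκ₁ ha hτ hδ hθ0 hθ1 hκθ hstab hU'b hU''b hU₃b hU₄b ψ
          (EuclideanSpace.single x (1 : ℝ)) (EuclideanSpace.single y (1 : ℝ)) (EuclideanSpace.single z (1 : ℝ)) (EuclideanSpace.single t (1 : ℝ))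
          (EuclideanSpace.single s (1 : ℝ))).deriv
  -- the placements' row letters (pieces BY NAME; reindexed by (595), `x`-factor to the front by (596))
  have h1 := ((sum4_ytsz _).trans_le ((Finset.sum_le_sum fun y _ => Finset.sum_le_sum fun z _ => Finset.sum_le_sum fun t _ => Finset.sum_le_sum fun s
      _ => fourthgrad_cov_entry hΓop Y hUd hU'd hU₄d hHk hHk0 hK5 hκ₀ hτ hδ hθ1 hκθ' hκθw hstab ψ hαr hαc hhr hlamA hlamA1 hγ hγ1 hD hDC x y z t
      s).trans (two_point5_lone_last_sum_le hK50 hHk0 hαr hαc hhc hk5r hD hDr hDc hl1 x)))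
  have h2 := ((cov_rowsum_symm _ _ _ _ _ _).trans_le ((sum4_zyts _).trans_le ((Finset.sum_le_sum fun y _ => Finset.sum_le_sum fun z _ =>
      Finset.sum_le_sum fun t _ => Finset.sum_le_sum fun s _ => hessthird_cov_entry hΓop Y hUd hU'd hU''d hU₃d hHk hHk0 hK3 hK4 hκ₀ hτ hδ hθ1 hκθ'
      hκθw hstab ψ hαr hαc hhr hlamA hlamA1 hγ hγ1 hD hDC x y z t s).trans (two_point5_hess_first_sum_le hK40 hK30 hαr hαc hk3r hk4c hD hDr hDc hl1
      x))))
  have h3 := ((cm3_rowsum_cyc _ _ _ _ _ _ _ _ _).trans_le ((sum4_ytsz _).trans_le (three_point5_row_letter_third_two hΓop Y hUd hU'd hU''d hU₃d hU₄c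
      hκ₀ hκ₁ ha hτ hδ hθ0 hθ1 hκθ hκθw hstab hU'b hU''b hU₃b hU₄b hlam hUsec hρg hHk hHk0 hK4 ψ hK40 hαr hαc hhr hlamA hlamA1 hγ hγ1 hD hDC hθnn
      hDθr hdθ hDθc hdθ' hσ0 hσθ hρ1 hρsymm hρmul hρσ haσ hβ haσ' hkσ hkσ' x hS hK3 hn3)))
  have h4 := ((sum4_yzst _).trans_le ((Finset.sum_le_sum fun y _ => Finset.sum_le_sum fun z _ => Finset.sum_le_sum fun t _ => Finset.sum_le_sum fun s
      _ => fourthgrad_cov_entry hΓop Y hUd hU'd hU₄d hHk hHk0 hK5 hκ₀ hτ hδ hθ1 hκθ' hκθw hstab ψ hαr hαc hhr hlamA hlamA1 hγ hγ1 hD hDC x y z t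
      s).trans (two_point5_lone_last_sum_le hK50 hHk0 hαr hαc hhc hk5r hD hDr hDc hl1 x)))
  have h5 := ((cov_rowsum_symm _ _ _ _ _ _).trans_le ((sum4_tyzs _).trans_le ((Finset.sum_le_sum fun y _ => Finset.sum_le_sum fun z _ =>
      Finset.sum_le_sum fun t _ => Finset.sum_le_sum fun s _ => hessthird_cov_entry hΓop Y hUd hU'd hU''d hU₃d hHk hHk0 hK3 hK4 hκ₀ hτ hδ hθ1 hκθ'
      hκθw hstab ψ hαr hαc hhr hlamA hlamA1 hγ hγ1 hD hDC x y z t s).trans (two_point5_hess_first_sum_le hK40 hK30 hαr hαc hk3r hk4c hD hDr hDc hl1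
      x))))
  have h6 := ((cm3_rowsum_cyc _ _ _ _ _ _ _ _ _).trans_le ((sum4_yzst _).trans_le (three_point5_row_letter_third_two hΓop Y hUd hU'd hU''d hU₃d hU₄c
      hκ₀ hκ₁ ha hτ hδ hθ0 hθ1 hκθ hκθw hstab hU'b hU''b hU₃b hU₄b hlam hUsec hρg hHk hHk0 hK4 ψ hK40 hαr hαc hhr hlamA hlamA1 hγ hγ1 hD hDC hθnn
      hDθr hdθ hDθc hdθ' hσ0 hσθ hρ1 hρsymm hρmul hρσ haσ hβ haσ' hkσ hkσ' x hS hK3 hn3)))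
  have h7 := (Finset.sum_le_sum fun y _ => Finset.sum_le_sum fun z _ => Finset.sum_le_sum fun t _ => Finset.sum_le_sum fun s _ =>
      fourthgrad_cov_entry hΓop Y hUd hU'd hU₄d hHk hHk0 hK5 hκ₀ hτ hδ hθ1 hκθ' hκθw hstab ψ hαr hαc hhr hlamA hlamA1 hγ hγ1 hD hDC x y z t s).trans
      (two_point5_lone_last_sum_le hK50 hHk0 hαr hαc hhc hk5r hD hDr hDc hl1 x)
  have h8 := ((cov_rowsum_symm _ _ _ _ _ _).trans_le ((sum4_syzt _).trans_le ((Finset.sum_le_sum fun y _ => Finset.sum_le_sum fun z _ =>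
      Finset.sum_le_sum fun t _ => Finset.sum_le_sum fun s _ => hessthird_cov_entry hΓop Y hUd hU'd hU''d hU₃d hHk hHk0 hK3 hK4 hκ₀ hτ hδ hθ1 hκθ'
      hκθw hstab ψ hαr hαc hhr hlamA hlamA1 hγ hγ1 hD hDC x y z t s).trans (two_point5_hess_first_sum_le hK40 hK30 hαr hαc hk3r hk4c hD hDr hDc hl1
      x))))
  have h9 := ((cm3_rowsum_cyc _ _ _ _ _ _ _ _ _).trans_le (three_point5_row_letter_third_two hΓop Y hUd hU'd hU''d hU₃d hU₄c hκ₀ hκ₁ ha hτ hδ hθ0 hθ1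
      hκθ hκθw hstab hU'b hU''b hU₃b hU₄b hlam hUsec hρg hHk hHk0 hK4 ψ hK40 hαr hαc hhr hlamA hlamA1 hγ hγ1 hD hDC hθnn hDθr hdθ hDθc hdθ' hσ0 hσθ
      hρ1 hρsymm hρmul hρσ haσ hβ haσ' hkσ hkσ' x hS hK3 hn3))
  have h10 := (Finset.sum_le_sum fun y _ => Finset.sum_le_sum fun z _ => Finset.sum_le_sum fun t _ => Finset.sum_le_sum fun s _ =>
      hessthird_cov_entry hΓop Y hUd hU'd hU''d hU₃d hHk hHk0 hK3 hK4 hκ₀ hτ hδ hθ1 hκθ' hκθw hstab ψ hαr hαc hhr hlamA hlamA1 hγ hγ1 hD hDC x y z t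
      s).trans (two_point5_hess_first_sum_le hK40 hK30 hαr hαc hk3r hk4c hD hDr hDc hl1 x)
  have h11 := ((cov_rowsum_symm _ _ _ _ _ _).trans_le ((sum4_ztsy _).trans_le ((Finset.sum_le_sum fun y _ => Finset.sum_le_sum fun z _ =>
      Finset.sum_le_sum fun t _ => Finset.sum_le_sum fun s _ => fourthgrad_cov_entry hΓop Y hUd hU'd hU₄d hHk hHk0 hK5 hκ₀ hτ hδ hθ1 hκθ' hκθw hstab
      ψ hαr hαc hhr hlamA hlamA1 hγ hγ1 hD hDC x y z t s).trans (two_point5_lone_last_sum_le hK50 hHk0 hαr hαc hhc hk5r hD hDr hDc hl1 x))))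
  have h12 := ((cm3_rowsum_swap13 _ _ _ _ _ _ _ _ _).trans_le ((sum4_ztsy _).trans_le (three_point5_row_letter_third_two hΓop Y hUd hU'd hU''d hU₃d
      hU₄c hκ₀ hκ₁ ha hτ hδ hθ0 hθ1 hκθ hκθw hstab hU'b hU''b hU₃b hU₄b hlam hUsec hρg hHk hHk0 hK4 ψ hK40 hαr hαc hhr hlamA hlamA1 hγ hγ1 hD hDC
      hθnn hDθr hdθ hDθc hdθ' hσ0 hσθ hρ1 hρsymm hρmul hρσ haσ hβ haσ' hkσ hkσ' x hS hK3 hn3)))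
  beta_reduce at h1 h2 h3 h4 h5 h6 h8 h9 h11 h12
  -- assemble
  refine (sum4_abs_split_cov4 _ _ _ _ _ _ _ _ _ _ _ _).trans ?_
  have hsum := add_le_add (add_le_add (add_le_add (add_le_add (add_le_add (add_le_add (add_le_add (add_le_add (add_le_add (add_le_add (add_le_add h1
      h2) h3) h4) h5) h6) h7) h8) h9) h10) h11) h12
  exact hsum.trans (le_of_eq (by ring))

set_option synthInstance.maxHeartbeats 200000 in
set_option maxHeartbeats 400000 in
/-- **Group three (the `Cov(B,B)` group)**: the row letter of the three differentiated raw covariances `Cov(U″·,U″·)` — nine placements: (563)'s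
`Cov(U‴x··,U″··)` entry with (564)'s letter (both placements, the second after symmetry), (575)'s `κ₃ᶜ(U′x,U″,U″)` letter. [folklore] -/
theorem fifth_kernel_group_covBB [Nonempty κ]
    (hΓop : (γop • (1 : Matrix ι ι ℝ) - A * Aᵀ).PosSemidef) (Y : Finset ι) (hUd : ∀ φ : EuclideanSpace ℝ ι, HasFDerivAt U (U' φ) φ)
    (hU'd : ∀ φ : EuclideanSpace ℝ ι, HasFDerivAt U' (U'' φ) φ) (hU''d : ∀ φ : EuclideanSpace ℝ ι, HasFDerivAt U'' (U₃ φ) φ)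
    (hU₃d : ∀ φ : EuclideanSpace ℝ ι, HasFDerivAt U₃ (U₄ φ) φ) (hκ₀ : 0 ≤ κ₀) (hκ₁ : 0 ≤ κ₁) (ha : 0 ≤ a) (hτ : 0 < τ) (hδ : 0 < δ) (hθ0 : 0 < θp)
    (hθ1 : θp < 1) (hκθ : (2 * κ₀ * (1 + τ) + 4 * δ) * γop ≤ θp) (hκθw : 2 * κ₀ * (1 + τ) * γop + 4 * δ ≤ θp)
    (hstab : ∀ φ : EuclideanSpace ℝ ι, -(κ₀ * ∑ x ∈ Y, φ x ^ 2) ≤ U φ) (hU'b : ∀ φ : EuclideanSpace ℝ ι, ‖U' φ‖ ≤ κ₁ * (a + ∑ x ∈ Y, φ x ^ 2))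
    (hU''b : ∀ φ : EuclideanSpace ℝ ι, ‖U'' φ‖ ≤ κ₂) (hU₃b : ∀ φ : EuclideanSpace ℝ ι, ‖U₃ φ‖ ≤ κ₃) (hlam : 0 ≤ lam)
    (hUsec : ∀ s : ℝ, 0 ≤ s → s ≤ 1 → ∀ a b : EuclideanSpace ℝ ι,
      U ((1 - s) • a + s • b) - lam / 2 * (s * (1 - s)) * ∑ i, (a i - b i) ^ 2 ≤ (1 - s) * U a + s * U b)
    (hρg : lam * γop < 1)
    (hHk : ∀ (φ : EuclideanSpace ℝ ι) (x z : ι), |U'' φ (EuclideanSpace.single z (1 : ℝ)) (EuclideanSpace.single x (1 : ℝ))| ≤ Hk x z)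
    (hHk0 : ∀ v u, 0 ≤ Hk v u)
    (hK3 : ∀ (φ : EuclideanSpace ℝ ι) (u x y : ι),
      |U₃ φ (EuclideanSpace.single u (1 : ℝ)) (EuclideanSpace.single x (1 : ℝ)) (EuclideanSpace.single y (1 : ℝ))| ≤ K3 x y u)
    (hK30 : ∀ x y u, 0 ≤ K3 x y u)
    (hK4 : ∀ (φ : EuclideanSpace ℝ ι) (u x y z : ι), |U₄ φ (EuclideanSpace.single u (1 : ℝ)) (EuclideanSpace.single x (1 : ℝ))
      (EuclideanSpace.single y (1 : ℝ)) (EuclideanSpace.single z (1 : ℝ))| ≤ K4 x y z u)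
    (hK40 : ∀ x y z u, 0 ≤ K4 x y z u) (hhr : ∀ v, ∑ u, Hk v u ≤ hr) (hk3c : ∀ u, ∑ y, ∑ z, K3 y z u ≤ k3c)
    (hk4r : ∀ x, ∑ y, ∑ z, ∑ u, K4 x y z u ≤ k4r) (ψ : EuclideanSpace ℝ ι) (hαr : ∀ u, ∑ w, |A u w| ≤ αr) (hαc : ∀ w, ∑ u, |A u w| ≤ αc)
    (hlamA : ∀ x : κ, ∑ u, ∑ v, |A u x| * |A v x| * Hk v u ≤ lamA) (hlamA1 : lamA < 1) (hγ : αc * hr * αr / (1 - lamA) ≤ γ) (hγ1 : γ < 1)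
    (hD : ∀ x y, 0 ≤ D x y)
    (hDC : ∀ x y, (if x = y then (1 : ℝ) else 0) + ∑ z, D x z * ((if y = z then 0 else ∑ u, ∑ v, |A u y| * |A v z| * Hk v u) / (1 - lamA)) ≤ D x y)
    (hDr : ∀ z, ∑ w, D z w ≤ dr) (hDc : ∀ w, ∑ z, D z w ≤ dc) (hθnn : ∀ z w, 0 ≤ θ z w) (hDθr : ∀ z, ∑ w, D z w * θ z w ≤ dθ) (hdθ : 0 ≤ dθ)
    (hDθc : ∀ w, ∑ z, D z w * θ z w ≤ dθ') (hdθ' : 0 ≤ dθ') (hσ0 : ∀ x w, 0 ≤ σ x w) (hσθ : ∀ x z w, σ x w ≤ σ x z * θ z w) (hρ1 : ∀ x y, 1 ≤ ρ x y)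
    (hρsymm : ∀ x y, ρ x y = ρ y x) (hρmul : ∀ x y z, ρ x z ≤ ρ x y * ρ y z) (hρσ : ∀ x y w, ρ x y ^ 8 ≤ σ x w * σ y w)
    (haσ : ∀ v : ι, ∑ w, (∑ u, |A u w| * Hk v u) * σ v w ≤ αθ) (hβ : 0 ≤ βθ) (haσ' : ∀ (v : ι) (w : κ), (∑ u, |A u w| * Hk v u) * σ v w ≤ βθ)
    (hgσ : ∀ p q : ι, ∑ w, (∑ u, |A u w| * K3 p q u) * σ p w ≤ αθ) (hgσ' : ∀ (p q : ι) (w : κ), (∑ u, |A u w| * K3 p q u) * σ p w ≤ βθ) (x : ι)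
    (hS : ∑ v, 1 / ρ x v ≤ S) (hn : ∀ y : ι, (Finset.univ.filter (fun z => Hk z y ≠ 0)).card ≤ n) :
    ∑ y, ∑ z, ∑ t, ∑ s, |deriv (fun σ : ℝ => ((∫ ω : EuclideanSpace ℝ ι, exp (-U (ω + (ψ + σ • EuclideanSpace.single x (1 : ℝ))))
        ∂(multivariateGaussian 0 (A * Aᵀ)))⁻¹ * (∫ ω : EuclideanSpace ℝ ι, exp (-U (ω + (ψ + σ • EuclideanSpace.single x (1 : ℝ)))) * (U'' (ω + (ψ +
        σ • EuclideanSpace.single x (1 : ℝ))) (EuclideanSpace.single y (1 : ℝ)) (EuclideanSpace.single z (1 : ℝ)) * U'' (ω + (ψ + σ •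
        EuclideanSpace.single x (1 : ℝ))) (EuclideanSpace.single t (1 : ℝ)) (EuclideanSpace.single s (1 : ℝ))) ∂(multivariateGaussian 0 (A * Aᵀ))) -
        ((∫ ω : EuclideanSpace ℝ ι, exp (-U (ω + (ψ + σ • EuclideanSpace.single x (1 : ℝ)))) ∂(multivariateGaussian 0 (A * Aᵀ))) ^ 2)⁻¹ * ((∫ ω :
        EuclideanSpace ℝ ι, exp (-U (ω + (ψ + σ • EuclideanSpace.single x (1 : ℝ)))) * U'' (ω + (ψ + σ • EuclideanSpace.single x (1 : ℝ)))
        (EuclideanSpace.single y (1 : ℝ)) (EuclideanSpace.single z (1 : ℝ)) ∂(multivariateGaussian 0 (A * Aᵀ))) * (∫ ω : EuclideanSpace ℝ ι, exp (-U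
        (ω + (ψ + σ • EuclideanSpace.single x (1 : ℝ)))) * U'' (ω + (ψ + σ • EuclideanSpace.single x (1 : ℝ))) (EuclideanSpace.single t (1 : ℝ))
        (EuclideanSpace.single s (1 : ℝ)) ∂(multivariateGaussian 0 (A * Aᵀ))))) +
        ((∫ ω : EuclideanSpace ℝ ι, exp (-U (ω + (ψ + σ • EuclideanSpace.single x (1 : ℝ)))) ∂(multivariateGaussian 0 (A * Aᵀ)))⁻¹ * (∫ ω :
            EuclideanSpace ℝ ι, exp (-U (ω + (ψ + σ • EuclideanSpace.single x (1 : ℝ)))) * (U'' (ω + (ψ + σ • EuclideanSpace.single x (1 : ℝ)))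
            (EuclideanSpace.single y (1 : ℝ)) (EuclideanSpace.single t (1 : ℝ)) * U'' (ω + (ψ + σ • EuclideanSpace.single x (1 : ℝ)))
            (EuclideanSpace.single z (1 : ℝ)) (EuclideanSpace.single s (1 : ℝ))) ∂(multivariateGaussian 0 (A * Aᵀ))) - ((∫ ω : EuclideanSpace ℝ ι,
            exp (-U (ω + (ψ + σ • EuclideanSpace.single x (1 : ℝ)))) ∂(multivariateGaussian 0 (A * Aᵀ))) ^ 2)⁻¹ * ((∫ ω : EuclideanSpace ℝ ι, exp (-U
            (ω + (ψ + σ • EuclideanSpace.single x (1 : ℝ)))) * U'' (ω + (ψ + σ • EuclideanSpace.single x (1 : ℝ))) (EuclideanSpace.single y (1 : ℝ))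
            (EuclideanSpace.single t (1 : ℝ)) ∂(multivariateGaussian 0 (A * Aᵀ))) * (∫ ω : EuclideanSpace ℝ ι, exp (-U (ω + (ψ + σ •
            EuclideanSpace.single x (1 : ℝ)))) * U'' (ω + (ψ + σ • EuclideanSpace.single x (1 : ℝ))) (EuclideanSpace.single z (1 : ℝ))
            (EuclideanSpace.single s (1 : ℝ)) ∂(multivariateGaussian 0 (A * Aᵀ))))) +
        ((∫ ω : EuclideanSpace ℝ ι, exp (-U (ω + (ψ + σ • EuclideanSpace.single x (1 : ℝ)))) ∂(multivariateGaussian 0 (A * Aᵀ)))⁻¹ * (∫ ω :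
            EuclideanSpace ℝ ι, exp (-U (ω + (ψ + σ • EuclideanSpace.single x (1 : ℝ)))) * (U'' (ω + (ψ + σ • EuclideanSpace.single x (1 : ℝ)))
            (EuclideanSpace.single y (1 : ℝ)) (EuclideanSpace.single s (1 : ℝ)) * U'' (ω + (ψ + σ • EuclideanSpace.single x (1 : ℝ)))
            (EuclideanSpace.single z (1 : ℝ)) (EuclideanSpace.single t (1 : ℝ))) ∂(multivariateGaussian 0 (A * Aᵀ))) - ((∫ ω : EuclideanSpace ℝ ι,
            exp (-U (ω + (ψ + σ • EuclideanSpace.single x (1 : ℝ)))) ∂(multivariateGaussian 0 (A * Aᵀ))) ^ 2)⁻¹ * ((∫ ω : EuclideanSpace ℝ ι, exp (-U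
            (ω + (ψ + σ • EuclideanSpace.single x (1 : ℝ)))) * U'' (ω + (ψ + σ • EuclideanSpace.single x (1 : ℝ))) (EuclideanSpace.single y (1 : ℝ))
            (EuclideanSpace.single s (1 : ℝ)) ∂(multivariateGaussian 0 (A * Aᵀ))) * (∫ ω : EuclideanSpace ℝ ι, exp (-U (ω + (ψ + σ •
            EuclideanSpace.single x (1 : ℝ)))) * U'' (ω + (ψ + σ • EuclideanSpace.single x (1 : ℝ))) (EuclideanSpace.single z (1 : ℝ))
            (EuclideanSpace.single t (1 : ℝ)) ∂(multivariateGaussian 0 (A * Aᵀ)))))) 0| ≤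
      αr * k4r * (αc * k3c) * dr * dc / (1 - lamA) +
        αr * k4r * (αc * k3c) * dr * dc / (1 - lamA) +
        (n : ℝ) * n * ((4 * Real.sqrt ((5 * ((κ₂ ^ 4 + κ₃ ^ 4) * γop ^ 2) / (1 - lam * γop) ^ 2) * (αθ * dθ * (βθ * dθ') / (1 - lamA)))) * S ^ 2) +
        αr * k4r * (αc * k3c) * dr * dc / (1 - lamA) +
        αr * k4r * (αc * k3c) * dr * dc / (1 - lamA) +
        (n : ℝ) * n * ((4 * Real.sqrt ((5 * ((κ₂ ^ 4 + κ₃ ^ 4) * γop ^ 2) / (1 - lam * γop) ^ 2) * (αθ * dθ * (βθ * dθ') / (1 - lamA)))) * S ^ 2) +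
        αr * k4r * (αc * k3c) * dr * dc / (1 - lamA) +
        αr * k4r * (αc * k3c) * dr * dc / (1 - lamA) +
        (n : ℝ) * n * ((4 * Real.sqrt ((5 * ((κ₂ ^ 4 + κ₃ ^ 4) * γop ^ 2) / (1 - lam * γop) ^ 2) * (αθ * dθ * (βθ * dθ') / (1 - lamA)))) * S ^ 2) :=
            by
  have hΓ : (A * Aᵀ).PosSemidef := posSemidef_AAT A
  have hU₃c : Continuous U₃ := continuous_iff_continuousAt.2 fun φ => (hU₃d φ).continuousAt
  have hκθ' : 2 * κ₀ * (1 + τ) * γop ≤ θp := mul_opBound_le_of_le (by positivity) (by linarith) hθ0.le hκθ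
  have hl1 : 0 < 1 - lamA := by linarith
  -- the group's derivative, entry by entry (`hasDerivAt_display4_covBB_line`)
  apply Eq.trans_le
  · exact Finset.sum_congr rfl fun y _ => Finset.sum_congr rfl fun z _ => Finset.sum_congr rfl fun t _ => Finset.sum_congr rfl fun s _ =>
      congrArg abs (hasDerivAt_display4_covBB_line hΓ hΓop Y hUd hU'd hU''d hU₃c hκ₀ hκ₁ ha hτ hδ hθ0 hθ1 hκθ hstab hU'b hU''b hU₃b ψ
          (EuclideanSpace.single x (1 : ℝ)) (EuclideanSpace.single y (1 : ℝ)) (EuclideanSpace.single z (1 : ℝ)) (EuclideanSpace.single t (1 : ℝ))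
          (EuclideanSpace.single s (1 : ℝ))).deriv
  -- the placements' row letters (pieces BY NAME; reindexed by (595), `x`-factor to the front by (596))
  have h1 := (Finset.sum_le_sum fun y _ => Finset.sum_le_sum fun z _ => Finset.sum_le_sum fun t _ => Finset.sum_le_sum fun s _ => thirdhess_cov_entry
      hΓop Y hUd hU'd hU''d hU₃d hHk hHk0 hK3 hK4 hκ₀ hτ hδ hθ1 hκθ' hκθw hstab ψ hαr hαc hhr hlamA hlamA1 hγ hγ1 hD hDC x y z t s).trans
      (two_point5_third_first_sum_le hK40 hK30 hαr hαc hk4r hk3c hD hDr hDc hl1 x)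
  have h2 := ((cov_rowsum_symm _ _ _ _ _ _).trans_le ((sum4_tsyz _).trans_le ((Finset.sum_le_sum fun y _ => Finset.sum_le_sum fun z _ =>
      Finset.sum_le_sum fun t _ => Finset.sum_le_sum fun s _ => thirdhess_cov_entry hΓop Y hUd hU'd hU''d hU₃d hHk hHk0 hK3 hK4 hκ₀ hτ hδ hθ1 hκθ'
      hκθw hstab ψ hαr hαc hhr hlamA hlamA1 hγ hγ1 hD hDC x y z t s).trans (two_point5_third_first_sum_le hK40 hK30 hαr hαc hk4r hk3c hD hDr hDc hl1
      x))))
  have h3 := ((cm3_rowsum_cyc _ _ _ _ _ _ _ _ _).trans_le (three_point5_row_letter_hesshess_two hΓop Y hUd hU'd hU''d hU₃c hκ₀ hκ₁ ha hτ hδ hθ0 hθ1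
      hκθ hκθw hstab hU'b hU''b hU₃b hlam hUsec hρg hHk hHk0 hK3 ψ hK30 hαr hαc hhr hlamA hlamA1 hγ hγ1 hD hDC hθnn hDθr hdθ hDθc hdθ' hσ0 hσθ hρ1
      hρsymm hρmul hρσ haσ hβ haσ' hgσ hgσ' x hS hn))
  have h4 := ((sum4_ytzs _).trans_le ((Finset.sum_le_sum fun y _ => Finset.sum_le_sum fun z _ => Finset.sum_le_sum fun t _ => Finset.sum_le_sum fun s
      _ => thirdhess_cov_entry hΓop Y hUd hU'd hU''d hU₃d hHk hHk0 hK3 hK4 hκ₀ hτ hδ hθ1 hκθ' hκθw hstab ψ hαr hαc hhr hlamA hlamA1 hγ hγ1 hD hDC x y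
      z t s).trans (two_point5_third_first_sum_le hK40 hK30 hαr hαc hk4r hk3c hD hDr hDc hl1 x)))
  have h5 := ((cov_rowsum_symm _ _ _ _ _ _).trans_le ((sum4_zsyt _).trans_le ((Finset.sum_le_sum fun y _ => Finset.sum_le_sum fun z _ =>
      Finset.sum_le_sum fun t _ => Finset.sum_le_sum fun s _ => thirdhess_cov_entry hΓop Y hUd hU'd hU''d hU₃d hHk hHk0 hK3 hK4 hκ₀ hτ hδ hθ1 hκθ'
      hκθw hstab ψ hαr hαc hhr hlamA hlamA1 hγ hγ1 hD hDC x y z t s).trans (two_point5_third_first_sum_le hK40 hK30 hαr hαc hk4r hk3c hD hDr hDc hl1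
      x))))
  have h6 := ((cm3_rowsum_cyc _ _ _ _ _ _ _ _ _).trans_le ((sum4_ytzs _).trans_le (three_point5_row_letter_hesshess_two hΓop Y hUd hU'd hU''d hU₃c
      hκ₀ hκ₁ ha hτ hδ hθ0 hθ1 hκθ hκθw hstab hU'b hU''b hU₃b hlam hUsec hρg hHk hHk0 hK3 ψ hK30 hαr hαc hhr hlamA hlamA1 hγ hγ1 hD hDC hθnn hDθr hdθ
      hDθc hdθ' hσ0 hσθ hρ1 hρsymm hρmul hρσ haσ hβ haσ' hgσ hgσ' x hS hn)))
  have h7 := ((sum4_yszt _).trans_le ((Finset.sum_le_sum fun y _ => Finset.sum_le_sum fun z _ => Finset.sum_le_sum fun t _ => Finset.sum_le_sum fun s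
      _ => thirdhess_cov_entry hΓop Y hUd hU'd hU''d hU₃d hHk hHk0 hK3 hK4 hκ₀ hτ hδ hθ1 hκθ' hκθw hstab ψ hαr hαc hhr hlamA hlamA1 hγ hγ1 hD hDC x y
      z t s).trans (two_point5_third_first_sum_le hK40 hK30 hαr hαc hk4r hk3c hD hDr hDc hl1 x)))
  have h8 := ((cov_rowsum_symm _ _ _ _ _ _).trans_le ((sum4_ztys _).trans_le ((Finset.sum_le_sum fun y _ => Finset.sum_le_sum fun z _ =>
      Finset.sum_le_sum fun t _ => Finset.sum_le_sum fun s _ => thirdhess_cov_entry hΓop Y hUd hU'd hU''d hU₃d hHk hHk0 hK3 hK4 hκ₀ hτ hδ hθ1 hκθ'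
      hκθw hstab ψ hαr hαc hhr hlamA hlamA1 hγ hγ1 hD hDC x y z t s).trans (two_point5_third_first_sum_le hK40 hK30 hαr hαc hk4r hk3c hD hDr hDc hl1
      x))))
  have h9 := ((cm3_rowsum_cyc _ _ _ _ _ _ _ _ _).trans_le ((sum4_yszt _).trans_le (three_point5_row_letter_hesshess_two hΓop Y hUd hU'd hU''d hU₃c
      hκ₀ hκ₁ ha hτ hδ hθ0 hθ1 hκθ hκθw hstab hU'b hU''b hU₃b hlam hUsec hρg hHk hHk0 hK3 ψ hK30 hαr hαc hhr hlamA hlamA1 hγ hγ1 hD hDC hθnn hDθr hdθ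
      hDθc hdθ' hσ0 hσθ hρ1 hρsymm hρmul hρσ haσ hβ haσ' hgσ hgσ' x hS hn)))
  beta_reduce at h2 h3 h4 h5 h6 h7 h8 h9
  -- assemble
  refine (sum4_abs_split_cov3 _ _ _ _ _ _ _ _ _).trans ?_
  have hsum := add_le_add (add_le_add (add_le_add (add_le_add (add_le_add (add_le_add (add_le_add (add_le_add h1 h2) h3) h4) h5) h6) h7) h8) h9
  exact hsum.trans (le_of_eq (by ring))

/-! ## Toy -/

/-- Toy (the assembly's arithmetic): four equal two-point letters and one of the other placement collect. -/
example (L L' : ℝ) : L + L + L + L + L' = 4 * L + L' := by ring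

end Summit.QuantumFields.BalabanUV.T4Continuum.NE7b.SupFifthKernelGroupsOne

end
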